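import Summits.CriticalPhenomena.PercolationContinuityZ3.Theorems.PercNearOneGluingNoHeavyLowerTailSahiCombCylinderMinDegree
import Summits.CriticalPhenomena.PercolationContinuityZ3.Theorems.SahiMasterFamilySupport
import Summits.CriticalPhenomena.PercolationContinuityZ3.Theorems.SahiMasterFamilyTrichotomy

/-!
# The comb hierarchy for Sahi's `E_k`: the MINIMAL-MULTIDEGREE positivity (M⁺⁺-k) typed, its first proved instance (AND-events), and (M⁺⁺) ⇒ (M⁺)

Support file of the one-cut programme (crux `NoHeavyLowerTail`, stmt-CriticalPhenomena-4575; cell `prim-masterthm`, seat P5 gen 4; report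
`P5-LORENTZIAN-TEST.md` §9.1; INEQ-CLAIMS row (M⁺⁺-k)).  As a polynomial in `p_e`, `E_k(μ_p; 1_{U_0},…,1_{U_{k−1}})` has degree at most
`r_e(U) = #{i : e is pivotal for U_i}` (`Affects`), so the natural ("minimal") multidegree of the family is `r(U) ≤ k`.

* `MasterFamilyCombMinDegPos k` — **(M⁺⁺-k)** (`@[conjecture]`, an obligation of our theories, never a fact): for every finite cube and every
  `k` increasing events, `p ↦ E_k(μ_p; 1_U)` is a nonnegative combination of the tensor-Bernstein basis of multidegree `r(U)`.  Census (report §9.1,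
  two engines): 0 violations on (3,≤4) exhaustive [1.24e8 lines], (4,≤3), (5,≤3), (6,≤3), random (4,4) 6.9e7 lines, (5,4), (3,5) 1.8e8, (4,5), (6,4).
* `masterFamilyCombPos_of_minDegPos` — (M⁺⁺-k) ⇒ (M⁺-k) (degree elevation, `r_e ≤ k`), hence ⇒ `MasterFamilyNonneg k` = Sahi's `C_k` on product measures.
* **`minDegPos_cylinders`** — (M⁺⁺) HOLDS for every family of cylinder (AND-) events `[S_i] = {ω | S_i ⊆ ω}`, every `k`
  (`SahiCylMinDeg.combPos_sahiE_ind_cylinders_minDegree` + `affects_cylinder_iff`: `e` is pivotal for `[S]` iff `e ∈ S`).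
* **`masterFamilyCombMinDegPos_of_le_two`** — (M⁺⁺-k) is a THEOREM for `k ≤ 2` (`k = 2`: the law of total covariance `covFun_eq_secAt` run with
  exact degrees — a coordinate pivotal for both events costs `2`, for one `1`, for none `0`; `combPos_covFun_minDeg`).
HONEST LABEL: (M⁺⁺-k) is OPEN for general increasing events, `k ≥ 3` (census-clean). [this work]
-/

noncomputable section

open scoped Classical

namespace Summit.CriticalPhenomena.PercolationContinuityZ3.Theorems

open Finset Function
open Literature.Combinatorics.Sahi2008
open Literature.Probability.LatticeModels.Kahn2022 (Affects)
open Literature.Probability.Percolation (DeterminedBy determinedBy_iff)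
open Literature.Probability.Percolation.DecisionTree (ind ind_of_mem ind_of_not_mem ind_nonneg)
open SahiComb SahiCylMinDeg

namespace SahiComb

/-- **(M⁺⁺-k) — comb positivity of Sahi's `E_k` at the MINIMAL multidegree** (P5 report §9.1): for every finite `ι` and all increasing
`U_0,…,U_{k−1} ⊆ 2^ι`, `p ↦ E_k(μ_p; 1_U)` is a nonnegative combination of the tensor-Bernstein basis of multidegree
`r_e = #{i : e ∈ esupp(U_i)}` (`esupp` = the pivotal coordinates, `Affects`).  Implies `MasterFamilyCombPos k` (`masterFamilyCombPos_of_minDegPos`).  THEOREM for `k ≤ 2` (`masterFamilyCombMinDegPos_of_le_two`) and for cylinder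
families (`minDegPos_cylinders`); OPEN in general (census-clean, report §9.1).  An obligation of our theories, never a fact: use as
`(h : MasterFamilyCombMinDegPos k)`. [this work] [status: open for k ≥ 3] -/
@[conjecture] def MasterFamilyCombMinDegPos (k : ℕ) : Prop :=
  ∀ (ι : Type) [Fintype ι] (U : Fin k → Set (Set ι)), (∀ i, IsUpperSet (U i)) →
    CombPos (fun e => ∑ i, if e ∈ esupp (U i) then 1 else 0)
      (fun p => sahiE (bernoulliWeight p) k (fun i => ind (U i)))

/-- **(M⁺⁺-k) ⇒ (M⁺-k)**: the minimal multidegree is at most `k` in every coordinate (degree elevation `CombPos.mono`). [this work] -/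
theorem masterFamilyCombPos_of_minDegPos {k : ℕ} (h : MasterFamilyCombMinDegPos k) : MasterFamilyCombPos k :=
  fun ι _ U hU => (h ι U hU).mono fun e => by
    calc (∑ i : Fin k, if e ∈ esupp (U i) then 1 else (0 : ℕ)) ≤ ∑ _i : Fin k, 1 := Finset.sum_le_sum fun i _ => by split_ifs <;> omega
      _ = k := by simp

/-- Hence (M⁺⁺-k) ⇒ Sahi's `C_k` for every product measure. [this work] -/
theorem masterFamilyNonneg_of_minDegPos {k : ℕ} (h : MasterFamilyCombMinDegPos k) : MasterFamilyNonneg k :=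
  masterFamilyCombPos_le_masterFamilyNonneg k (masterFamilyCombPos_of_minDegPos h)

/-- The trivial level `k = 0` (`E_0 := 0`). [this work] -/
theorem masterFamilyCombMinDegPos_zero : MasterFamilyCombMinDegPos 0 :=
  fun _ _ _ _ => (CombPos.zero _).congr fun p => by rw [sahiE_zero]

variable {ι : Type} [Fintype ι]

omit [Fintype ι] in
/-- A coordinate is pivotal for the cylinder `[S]` iff it belongs to `S`. [folklore] -/
theorem affects_cylinder_iff (S : Set ι) (e : ι) : Affects {ω : Set ι | S ⊆ ω} e ↔ e ∈ S := by
  constructor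
  · rintro ⟨ω, hω, hins⟩
    by_contra he
    exact hω fun x hx => by
      have hx' := hins hx
      rcases (Set.mem_insert_iff.1 hx') with rfl | h'
      · exact absurd hx he
      · exact h'
  · intro he
    refine ⟨S \ {e}, fun h => ?_, fun x hx => ?_⟩
    · exact ((h he).2 rfl).elim
    · by_cases hxe : x = e
      · exact Set.mem_insert_iff.2 (Or.inl hxe)
      · exact Set.mem_insert_of_mem _ ⟨hx, hxe⟩

/-- The essential support of a cylinder `[S]` is `S`. [folklore] -/
theorem mem_esupp_cylinder_iff (S : Set ι) (e : ι) : e ∈ esupp {ω : Set ι | S ⊆ ω} ↔ e ∈ S := by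
  rw [mem_esupp, affects_cylinder_iff]

/-- **(M⁺⁺) for AND-events**: every family of cylinders satisfies the minimal-multidegree positivity, every `k`
(the essential supports of a cylinder family give `d_e = #{i : e ∈ S_i}`; `SahiCylMinDeg.combPos_sahiE_ind_cylinders_minDegree`). [this work] -/
theorem minDegPos_cylinders {k : ℕ} (S : Fin k → Set ι) :
    CombPos (fun e => ∑ i, if e ∈ esupp {ω : Set ι | S i ⊆ ω} then 1 else 0)
      (fun p => sahiE (bernoulliWeight p) k (fun i => ind {ω : Set ι | S i ⊆ ω})) :=
  combPos_of_deg_eq (combPos_sahiE_ind_cylinders_minDegree k S) (by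
    funext e
    exact Finset.sum_congr rfl fun i _ => by simp only [mem_esupp_cylinder_iff])

/-! ### The levels `k = 1` and `k = 2` -/

/-- (M⁺⁺-1): `E_1(U) = μ_p(U)` is comb-positive at multidegree `1_{esupp U}`. [this work] -/
theorem masterFamilyCombMinDegPos_one : MasterFamilyCombMinDegPos 1 := by
  intro ι _ U hU
  have hdeg : (fun e => ∑ i : Fin 1, if e ∈ esupp (U i) then 1 else (0 : ℕ)) = fun e => if e ∈ esupp (U 0) then 1 else 0 := by
    funext e; rw [Fin.sum_univ_one]
  rw [hdeg]
  exact (SahiCombSubstitution.combPos_ex_ind_supported (esupp (U 0)) (determinedBy_esupp (hU 0))).congr fun p => by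
    rw [sahiE_one_apply]

/-- The influence `μ_p(U^{e←1}) − μ_p(U^{e←0}) = μ_p(U^{e←1} ∖ U^{e←0})` is comb-positive at multidegree `1_{esupp U ∖ {e}}`. [this work] -/
theorem combPos_influence_supported {U : Set (Set ι)} (hU : IsUpperSet U) (e : ι) :
    CombPos (fun e' => if e' ∈ (esupp U).erase e then 1 else 0)
      (fun p => ex (bernoulliWeight p) (ind (secAt e true U)) - ex (bernoulliWeight p) (ind (secAt e false U))) := by
  have hle : ∀ ω, ind (secAt e false U) ω ≤ ind (secAt e true U) ω := fun ω => by
    by_cases h0 : ω ∈ secAt e false U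
    · rw [ind_of_mem h0, ind_of_mem (secAt_false_subset_true hU e h0)]
    · rw [ind_of_not_mem h0]; exact ind_nonneg _ ω
  have h1 : CombPos (fun _ : ι => 1)
      (fun p => ex (bernoulliWeight p) (ind (secAt e true U)) - ex (bernoulliWeight p) (ind (secAt e false U))) := by
    refine (combPos_ex (h := fun ω => ind (secAt e true U) ω - ind (secAt e false U) ω) fun ω => sub_nonneg.2 (hle ω)).congr
      fun p => ?_
    simp only [ex_def, mul_sub, sum_sub_distrib]
  have hd : ∀ b, DeterminedBy (secAt e b U) (↑((esupp U).erase e) : Set ι) := fun b =>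
    (determinedBy_esupp (isUpperSet_secAt e b hU)).mono fun x hx => Finset.mem_coe.2 (esupp_secAt_subset hU e b (Finset.mem_coe.1 hx))
  have h2 := SahiCombSubstitution.CombPos.of_ignores_finset (Finset.univ \ (esupp U).erase e) (fun e' he' p s => by
    have hne : e' ∉ (↑((esupp U).erase e) : Set ι) := fun h => (Finset.mem_sdiff.1 he').2 (Finset.mem_coe.1 h)
    simp only [SahiCombJunta.ex_ind_update_of_determinedBy p e' s (hd true) hne,
      SahiCombJunta.ex_ind_update_of_determinedBy p e' s (hd false) hne]) h1
  refine combPos_of_deg_eq h2 ?_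
  funext e'; by_cases he : e' ∈ (esupp U).erase e <;> simp [he]

/-- Sections shrink the essential support and lose the sectioned coordinate: the pair degree of the `e`-sections is at most the pair
degree with the `e`-entry set to `0`. [folklore] -/
theorem secDeg_le {U V : Set (Set ι)} (hU : IsUpperSet U) (hV : IsUpperSet V) (e : ι) (b : Bool) (e' : ι) :
    (if e' ∈ esupp (secAt e b U) then 1 else 0) + (if e' ∈ esupp (secAt e b V) then 1 else (0 : ℕ))
      ≤ update (fun e' => (if e' ∈ esupp U then 1 else 0) + (if e' ∈ esupp V then 1 else (0 : ℕ))) e 0 e' := by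
  have hU' := esupp_secAt_subset hU e b
  have hV' := esupp_secAt_subset hV e b
  by_cases he : e' = e
  · subst he
    rw [update_self, if_neg (fun h => Finset.notMem_erase e' _ (hU' h)), if_neg (fun h => Finset.notMem_erase e' _ (hV' h))]
  · rw [update_of_ne he]
    gcongr
    · split_ifs with h1 h2
      · exact le_rfl
      · exact absurd (Finset.mem_of_mem_erase (hU' h1)) h2
      · exact Nat.zero_le _
      · exact le_rfl
    · split_ifs with h1 h2
      · exact le_rfl
      · exact absurd (Finset.mem_of_mem_erase (hV' h1)) h2
      · exact Nat.zero_le _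
      · exact le_rfl

/-- **(M⁺⁺-2) for a pair determined by a given set** (induction on the set through the law of total covariance `covFun_eq_secAt`, with exact
degrees: a coordinate pivotal for both events costs `2`, for one event `1`, for none `0`). [this work] -/
theorem combPos_covFun_minDeg_of_determinedBy (S : Finset ι) :
    ∀ (U V : Set (Set ι)), IsUpperSet U → IsUpperSet V → DeterminedBy U (↑S : Set ι) → DeterminedBy V (↑S : Set ι) →
      CombPos (fun e => (if e ∈ esupp U then 1 else 0) + (if e ∈ esupp V then 1 else 0)) (covFun U V) := by
  induction S using Finset.induction_on with
  | empty =>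
    intro U V _ _ hUd hVd
    refine (CombPos.zero _).congr fun p => ?_
    simp only [covFun]
    rcases eq_empty_or_univ_of_determinedBy_empty hUd with hU0 | hU1
    · subst hU0
      have h0 : ind (∅ : Set (Set ι)) = 0 := funext fun ω => ind_of_not_mem (Set.notMem_empty ω)
      rw [Set.empty_inter, h0]; simp [ex_def]
    · subst hU1
      rw [Set.univ_inter, ind_univ_eq_one, ex_one (sum_bernoulliWeight p), one_mul, sub_self]
  | insert e S heS ih =>
    intro U V hU hV hUd hVd
    set r : ι → ℕ := fun e' => (if e' ∈ esupp U then 1 else 0) + (if e' ∈ esupp V then 1 else 0) with hr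
    have hsec : ∀ (b : Bool) (A : Set (Set ι)), IsUpperSet A → DeterminedBy A (↑(insert e S) : Set ι) →
        IsUpperSet (secAt e b A) ∧ DeterminedBy (secAt e b A) (↑S : Set ι) := fun b A hA hAd => by
      refine ⟨isUpperSet_secAt e b hA, ?_⟩
      have := determinedBy_secAt e b hAd
      rwa [erase_insert heS] at this
    -- induction hypothesis on the sections, at the restricted degree `r` with `r e ↦ 0`
    have hIH : ∀ b : Bool, CombPos (update r e 0) (covFun (secAt e b U) (secAt e b V)) := fun b =>
      (ih _ _ (hsec b U hU hUd).1 (hsec b V hV hVd).1 (hsec b U hU hUd).2 (hsec b V hV hVd).2).mono fun e' =>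
        secDeg_le hU hV e b e'
    -- the influence product has degree `update r e 0`
    have hdeg1 : (fun e' => if e' ∈ (esupp U).erase e then 1 else (0 : ℕ)) + (fun e' => if e' ∈ (esupp V).erase e then 1 else 0)
        = update r e 0 := by
      funext e'
      by_cases he : e' = e
      · subst he; simp
      · simp [hr, he, Finset.mem_erase]
    have hinfl := (combPos_influence_supported hU e).mul_of_eq (combPos_influence_supported hV e) hdeg1
    by_cases hUe : e ∈ esupp U <;> by_cases hVe : e ∈ esupp V
    · -- both pivotal: degree 2 at `e`, P3's assembly
      have hw2 : CombPos (Pi.single e 2) (fun p : ι → unitInterval => (1 - (p e : ℝ)) ^ 2) :=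
        (combPos_single e (Nat.zero_le 2)).congr fun p => by simp
      have hw0 : CombPos (Pi.single e 2) (fun p : ι → unitInterval => (p e : ℝ) ^ 2) :=
        (combPos_single e (le_refl 2)).congr fun p => by simp
      have hw1 : CombPos (Pi.single e 2) (fun p : ι → unitInterval => (p e : ℝ) * (1 - (p e : ℝ))) :=
        (combPos_single e (show 1 ≤ 2 by norm_num)).congr fun p => by simp
      have hdeg2 : Pi.single e 2 + update r e 0 = r := by
        funext e'
        by_cases he : e' = e
        · subst he; simp [hr, hUe, hVe]
        · simp [he]
      have hbr := ((hIH false).add (hIH true)).add hinfl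
      have htot := ((hw2.mul_of_eq (hIH false) hdeg2).add (hw0.mul_of_eq (hIH true) hdeg2)).add (hw1.mul_of_eq hbr hdeg2)
      refine htot.congr fun p => ?_
      rw [covFun_eq_secAt U V e p]
    · -- only `U` pivotal: `Cov(U,V) = (1−p_e)Cov(U⁰,V) + p_e Cov(U¹,V)`, degree 1 at `e`
      have hVsec : ∀ b, secAt e b V = V := fun b => secAt_eq_self_of_not_affects hV (fun h => hVe (mem_esupp.2 h)) b
      have hcovV : ∀ b, CombPos (update r e 0) (covFun (secAt e b U) V) := fun b => by
        have := hIH b; rwa [hVsec b] at this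
      have hdeg : Pi.single e 1 + update r e 0 = r := by
        funext e'
        by_cases he : e' = e
        · subst he; simp [hr, hUe, hVe]
        · simp [he]
      have htot := ((combPos_one_sub_coord e).mul_of_eq (hcovV false) hdeg).add ((combPos_coord e).mul_of_eq (hcovV true) hdeg)
      refine htot.congr fun p => ?_
      rw [covFun_eq_secAt U V e p, hVsec true, hVsec false]
      ring
    · -- only `V` pivotal: mirror image
      have hUsec : ∀ b, secAt e b U = U := fun b => secAt_eq_self_of_not_affects hU (fun h => hUe (mem_esupp.2 h)) b
      have hcovU : ∀ b, CombPos (update r e 0) (covFun U (secAt e b V)) := fun b => by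
        have := hIH b; rwa [hUsec b] at this
      have hdeg : Pi.single e 1 + update r e 0 = r := by
        funext e'
        by_cases he : e' = e
        · subst he; simp [hr, hUe, hVe]
        · simp [he]
      have htot := ((combPos_one_sub_coord e).mul_of_eq (hcovU false) hdeg).add ((combPos_coord e).mul_of_eq (hcovU true) hdeg)
      refine htot.congr fun p => ?_
      rw [covFun_eq_secAt U V e p, hUsec true, hUsec false]
      ring
    · -- `e` pivotal for neither: nothing depends on `e`
      have hUsec : ∀ b, secAt e b U = U := fun b => secAt_eq_self_of_not_affects hU (fun h => hUe (mem_esupp.2 h)) b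
      have hVsec : ∀ b, secAt e b V = V := fun b => secAt_eq_self_of_not_affects hV (fun h => hVe (mem_esupp.2 h)) b
      have h := hIH false
      rw [hUsec false, hVsec false] at h
      exact h.mono fun e' => by
        by_cases he : e' = e
        · subst he; simp
        · simp [he]

/-- **(M⁺⁺-2)**: the covariance of two increasing events is comb-positive at the minimal multidegree `1_{esupp U} + 1_{esupp V}`. [this work] -/
theorem combPos_covFun_minDeg (U V : Set (Set ι)) (hU : IsUpperSet U) (hV : IsUpperSet V) :
    CombPos (fun e => (if e ∈ esupp U then 1 else 0) + (if e ∈ esupp V then 1 else 0)) (covFun U V) :=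
  combPos_covFun_minDeg_of_determinedBy Finset.univ U V hU hV
    ((determinedBy_esupp hU).mono fun x _ => Finset.mem_coe.2 (Finset.mem_univ x))
    ((determinedBy_esupp hV).mono fun x _ => Finset.mem_coe.2 (Finset.mem_univ x))

/-- **(M⁺⁺-2) is a theorem.** [this work] -/
theorem masterFamilyCombMinDegPos_two : MasterFamilyCombMinDegPos 2 := by
  intro ι _ U hU
  have hdeg : (fun e => ∑ i : Fin 2, if e ∈ esupp (U i) then 1 else (0 : ℕ)) =
      fun e => (if e ∈ esupp (U 0) then 1 else 0) + (if e ∈ esupp (U 1) then 1 else 0) := by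
    funext e; rw [Fin.sum_univ_two]
  rw [hdeg]
  refine (combPos_covFun_minDeg (U 0) (U 1) (hU 0) (hU 1)).congr fun p => ?_
  rw [sahiE_two_apply, covFun]
  congr 2
  funext ω
  exact (Literature.Probability.Percolation.BHK2006.ind_inter (U 0) (U 1) ω).symm

/-- (M⁺⁺-k) holds for `k ≤ 2`. [this work] -/
theorem masterFamilyCombMinDegPos_of_le_two {k : ℕ} (hk : k ≤ 2) : MasterFamilyCombMinDegPos k := by
  interval_cases k
  · exact masterFamilyCombMinDegPos_zero
  · exact masterFamilyCombMinDegPos_one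
  · exact masterFamilyCombMinDegPos_two

end SahiComb

end Summit.CriticalPhenomena.PercolationContinuityZ3.Theorems
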